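import Summits.BirchSwinnertonDyer.Rank1Residual.ManinAdditive.UDCKummerLineK
import Summits.BirchSwinnertonDyer.Rank1Residual.ManinAdditive.ThreeIsogenyKernelLaws
import Summits.BirchSwinnertonDyer.Rank1Residual.Additive.SharpenedStatements
import HarnessLib
import HarnessLib.Audit.Tags

/-!
# The `μ₃`-edge Kodaira law at `3` and the Kodaira-typed dissolution of the Shimura stratum of RES₃♭
# (cell `bsd-f2-manin`, seat `-an` g39, MEMO-an §83; candidate statements + kernel-checked pure-logic edges)

HONEST FRAMING.  LENS = analytic / period-lattice (Néron lattices `Λ(W)`, Lie exponents of `3`-isogenies, the `Γ₀(N)`/`Γ₁(N)`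
period lattices `Λ₀(f) ⊇ Λ₁(f)`) joined to the LOCAL INVARIANT the cell's search question asks for: the Kodaira symbol of `W`
at `3`.  Nothing below is a theorem about the Manin constant; the `@[conjecture]` rows are DATA LAWS with their censuses, the
`theorem`s are pure logic over them and over the landed module `…ManinAdditive.UDCKummerLineK` (p-T-an-47, typer g21).

THE LAW (E-an-211 `MuThreeEdgeKodairaLaw`, answering «which local invariant at 3 controls the `3`-part of the Néron scalar of a
`μ₃`-isogeny at additive reduction»).  Let `W/ℚ` be globally minimal with ADDITIVE reduction at `3`, `φ : W → W₂` a rational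
`3`-isogeny whose kernel is of `μ₃`-TYPE (`HasMuThreeKernel`), `L, L₂` Néron period pairs.  Then
  `covol Λ(W₂) = 3·covol Λ(W)` (ASCENDING, Néron scalar `±3`)  ⟺  Kodaira(W at 3) ∈ {IV*, III*, II*}   («star»),
  `3·covol Λ(W₂) = covol Λ(W)`  (DESCENDING, Néron scalar `±1`) ⟺  Kodaira(W at 3) ∈ {II, I₀*, Iₙ* (n ≥ 1)} («low»),
and the types III, IV carry no `μ₃`-line at all.  In print the Néron scalar of an isogeny at `ℓ = p` with additive potentially
supersingular reduction is the UNDETERMINED entry «?» of [Dokchitser–Dokchitser, *Local invariants of isogenous elliptic curves*,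
Table 1] ([corpus:paper:arxiv-1208.5519 p.3], criterion (†): scalar `p` iff `ker φ ⊂ Ê(𝔪)`); the law fills that entry for
`p = 3`, `μ₃`-kernels over `ℚ₃` by the Kodaira symbol ALONE (the Tamagawa number does not decide it: IV* with `c₃ = 1` ascends,
106 cases `N < 10⁴`).  Dual reading (`φ̂` has constant kernel): a `ℤ/3`-edge `E_T → E_T/⟨T⟩` at additive `3` ascends iff the
TARGET has low type.  Provable route (not attempted here): `W₂ = E_T`, `W = E_T/⟨T⟩` runs over the Kubert family
`E_T : y² + a₁xy + a₃y = x³` (`Δ_T = a₃³(a₁³ − 27a₃)`), Vélu gives `W` explicitly (`Δ = a₃(a₁³ − 27a₃)³`), and a finite `3`-adic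
Tate case analysis — the tree already has the Table-II bridges at `3` (`kodairaSymbolAt_eq_tableKodairaSymbolThree`,
`conductorExponent_eq_tableConductorExponentThree_holds`) and the Barrios–Roy local data pattern [cite: BarriosRoy2022LocalData].
CENSUS (BC5; exact engines HOME/an/g39/census22/: local3-an-g39.py = Tate's algorithm at 3; mu3edge5-driver.py = the `μ₃`-carriers by
Cremona's galrep labels 3B.1.2 (non-split) / 3Cs.1.1 (split), the `μ₃`-line by exact `Ψ₃`-roots (psi3exact.py fallback), the Vélu quotient
matched inside the Cremona class by `j` and the `u`-scaling `u⁴ = c₄'/c₄''`, `u⁶ = c₆'/c₆''`, `k := v₃(u) = v₃(Néron scalar)`; out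
mu3edge5-all.txt 025a675111980e70): ALL curves with `9 ∣ N < 5·10⁵` (Cremona ecdata): 22 105 `μ₃`-edges — star ⟹ ascending
10 544/10 544 (IV* 3 840, III* 3 058, II* 3 646), low ⟹ descending 11 561/11 561 (II 2 682, I₀* 2 954, Iₙ* (n ≥ 1) 5 925); types III/IV:
0 of the 22 109 `μ₃`-carriers; 0 exceptions (4 carriers of very large height left unmatched by the root finder).  Earlier pass without the
galrep prefilter (mu3edge-driver.py, all stable `3`-lines, `N < 6·10⁴`): rational-kernel and generic-kernel edges are MIXED by source type.
Cheapest falsifier: one `μ₃`-edge at additive `3` with (star, descending) or (low, ascending) — a 2-line check per curve.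

THE SHIMURA STRATUM, KODAIRA-TYPED.  RES₃♭ (`CuspidalKummerThree.NoRationalThreeTorsionCoprimeIsolatedResidual`) was split in
`UDCKummerLineK` as EXISTC ∧ GENΣ ∧ KLINE♮ ∧ RESΣ, RESΣ = «Manin on the Shimura stratum» (an optimal `W`, `9 ∣ N`, whose `μ₃`-line
`⟨T⟩` has all `Γ₁(N)`-Kummer periods trivial, has `3 ∤ c`).  INSIDE RES₃♭ the stratum carries the extra hypothesis «no rational
point of order 3» (`hT`), and two `c`-FREE Kodaira laws empty it:
* **E-an-212 `NonShimuraMuThreeOfNonStarKodairaAtNine`**: optimal, `9 ∣ N`, Kodaira(3) NOT star ⟹ no `3`-division point `u` has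
  all its `Γ₁(N)`-Kummer periods trivial (`3 ∤ #(E₀ ∩ Σ(N))`).  It is IMPLIED BY MANIN at 3 given E-an-211 (a low-type Shimura `μ₃`
  descends, so `ord₃(c₀) = 1 + ord₃(c₁) ≥ 1` by the cell identity `n_u = ±c₀/c₁`, `n_φ n_u = 3`), hence weaker than the target and
  independently KILLABLE: census = every optimal `μ₃`-carrier of low type tested has an UNBOUNDED `μ₃`-Kummer cube root at a prime
  over 3 (so `⟨T⟩ ⊄ Σ`): 701/701 (the 688 orbit-minimal «χ₋₃-only ∪ isolated» classes `9 ∣ N < 10⁵` of HOME/data/D-an-18-coprime-partners-v1.tsv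
  — CENSUS-kummerK-N1e5-an-g39.txt 5b3a8dc15f7784f3: `min_k v_𝔭(h_k) ≤ −5` by `k ≤ 20` for all 688 — plus 54b1, 171b1, 198b1 and the
  ten RES₃♭ classes `N ≤ 5000` of MEMO-an §82).
* **E-an-214 `OptimalStarMuThreeCarrierSplitsAtNine`**: optimal, `9 ∣ N`, Kodaira(3) star, a `μ₃`-type point of order 3 ⟹ a RATIONAL
  point of order 3 (`E₀[3] ≅ μ₃ ⊕ ℤ/3`: Vatsal's sequence (5) `0 → μ₃ → E₀[3] → ℤ/3 → 0` SPLITS — [Vatsal2005, §5 p.40] constructs the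
  splitting by an Eisenstein series at SEMISTABLE level; at `9 ∣ N` it is open).  Equivalently (given E-an-211's «no III/IV»): an optimal
  NON-SPLIT `μ₃`-carrier (image 3B.1.2) has LOW Kodaira type at 3.  Census (mu3kod5-driver.py over galrep, `9 ∣ N < 5·10⁵`): optimal
  `μ₃`-carriers 10 194 = 9 970 non-split (3B.1.2) + 224 split (3Cs.1.1); the non-split ones are ALL low (9 970/9 970: II 2 459, I₀* 2 551,
  Iₙ* (n ≥ 1) 4 960; 0 star, 0 III/IV); the split ones are 222 of type II + EXACTLY 27a1, 54a1 of star type (IV*) — so the star optimal carriers are 2/2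
  split.  NOT a local statement: 10 323 NON-optimal non-split `μ₃`-carriers are star (27a2, 36a3, 54a2, …) against 903 low — optimality is
  load-bearing (Stevens-type input).  Cheapest falsifier: an optimal curve with image 3B.1.2 of type IV*, III* or II* at 3 beyond `5·10⁵`
  (2 s per 10⁵ conductors with the galrep prefilter).
PROVED here (pure logic): `shimuraMuThreeCaseAtNineFlat_of_kodaira : E-an-212 → E-an-214 → RESΣ♭` and the re-split
`noRationalThreeTorsionCoprimeIsolatedResidual_of_kLineFlat : EXISTC → GENΣ → KLINE♮ → RESΣ♭ → RES₃♭`, where RESΣ♭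
`ShimuraMuThreeCaseAtNineFlat` is RESΣ with RES₃♭'s own hypothesis `hT` threaded (trivially implied by RESΣ).  Net:
**RES₃♭ ⟸ EXISTC ∧ GENΣ ∧ KLINE♮ ∧ E-an-212 ∧ E-an-214** — the Manin constant now occurs only in KLINE♮ (= NCΣ ∧ (BI)_K ∧ (AN)_K,
the UDC line, NCΣ PROVED Theorems-side) and in the Manin-implied law E-an-212.

REPAIR OF E-an-201 (disclosure).  The landed `UDCKummerLineK.ShimuraKernelMuTypeAtNine` quantifies over every optimal datum with
`Λ₁(f) ≠ Λ₀(f)`; when `3 ∤ [Λ₀(f) : Λ₁(f)] = #(E₀ ∩ Σ(N))` (a Shimura kernel of order prime to 3 — at prime level `E₀ ∩ Σ ≅ μ₂`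
does occur for the Neumann–Setzer curves [corpus:paper:arxiv-math_0404333 p.6, Prop. 3.2]; nothing excludes it at `9 ∣ N`) one has
`Λ₁(f) + 3Λ₀(f) = Λ₀(f)`, so its conclusion (b) would make EVERY nonzero `3`-division point `μ₃`-type with rational abscissa, which the
Weil pairing forbids: E-an-201 is MISSTATED (class `misstated`; not refutable in the tree today only because no `Γ₁(N)`-period is
certified there).  The repaired row **E-an-201R `ShimuraKernelMuTypeAtNineR`** below carries the `3`-part hypothesis «`Λ₁(f)` lies in
a LINE `ℤg + 3Λ₀(f)`, `g ∈ Λ₀(f) ∖ 3Λ₀(f)`» (⟺ `3 ∣ #(E₀ ∩ Σ)`), which is literally what DICTΣ `KummerShimuraLattice` delivers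
(`g = 3u/c`); the GENΣ edge is re-proved from E-an-201R on the Theorems side (HOME/an/g39/ManinLocalTwoThreeMuThreeKodairaAtNine-an-g39.lean,
`kummerNotShimuraOfGeneric_of_muTypeR`).  The landed decl is left untouched (never reworded); refuters: treat E-an-201 as superseded.

PARTITION 0 new data jobs (local exact scripts ≤ 115 s each; `kit` not available to this seat) · beyond-print theorem: no (E-an-211 is a
candidate law filling a printed «?»; its proof is a finite Tate/Vélu computation not done here) · BSD is not proved by this.

TYPER NOTE (typer g21, T-an-48).  SOURCE = HOME/an/g39/MuThreeEdgeKodairaLaw-an-g39.lean (file C) sha16 31fe905359ffa80f (264 l.; an: farm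
rc 0 · 0 s∗rry · 0 warn; BC7 5/5 CLEAN g39-bc7-d.out 666101a3892abf73) VERBATIM except this note and ONE cite-key repair: an's
`DokchitserDokchitser2015` ↦ the tree's references.bib key `DokchitserDokchitser2015LocalInvariants` (same paper: T. & V. Dokchitser, «Local
invariants of isogenous elliptic curves», arXiv:1208.5519; the bare key is not in references.bib and would bounce `lint.tags`) — bodies,
names, an's own `@[conjecture]` tags, namespace `…ManinAdditive.MuThreeEdgeKodaira`, imports untouched.  ROUTE-INDEPENDENT: imports
`…ManinAdditive.UDCKummerLineK` (T-an-47, p734676), `…ManinAdditive.ThreeIsogenyKernelLaws` (p13-era leaf), `…Rank1Residual.Additive.SharpenedStatements`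
+ HarnessLib — 0 `Theses` edges in the transitive import cone (typer script).  CONTENT (an MEMO-an §83, HOME/an/MEMO-an-83.md 7d68dab47a60a2a2):
defs `IsStarKodairaAtThree` / `IsLowKodairaAtThree` (+ PROVED disjointness); `@[conjecture]` rows **E-an-211 `MuThreeEdgeKodairaLaw`** (the
μ₃-edge Kodaira law at additive 3: a μ₃-kernel 3-isogeny ASCENDS ⟺ Kodaira ∈ {IV*, III*, II*}, DESCENDS ⟺ {II, Iₙ*}, never III/IV — the
cell's candidate answer to «which local invariant at 3» on the μ₃ locus; fills the «?» of [DokchitserDokchitser2015LocalInvariants] Table 1 for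
p = 3 μ₃-kernels), **E-an-212 `NonShimuraMuThreeOfNonStarKodairaAtNine`** (Manin-implied data law), **E-an-214
`OptimalStarMuThreeCarrierSplitsAtNine`** (Stevens/Vatsal-type data law; optimality load-bearing), **RESΣ♭ `ShimuraMuThreeCaseAtNineFlat`** (RESΣ
with RES₃♭'s `hT` threaded), **E-an-201R `ShimuraKernelMuTypeAtNineR`** (REPAIR of the landed E-an-201 `UDCKummerLineK.ShimuraKernelMuTypeAtNine`,
which an (§83) and ref1 (§R182 BC7 note) class MISSTATED: Λ₁ ≠ Λ₀ admits Shimura kernels of order prime to 3; the repaired row carries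
the 3-part / line hypothesis = DICTΣ's output; the landed decl is left untouched — bodies are immutable; a SUPERSEDED docstring paragraph on
E-an-201 is OWED at the next substantive append to `UDCKummerLineK.lean`); PROVED (an, pure logic, kernel-checked here):
`isStarKodairaAtThree_of_ascending`, `shimuraMuThreeCaseAtNineFlat_of_resSigma` (RESΣ ⟹ RESΣ♭), `shimuraMuThreeCaseAtNineFlat_of_kodaira`
(E-an-212 → E-an-214 → RESΣ♭), `noRationalThreeTorsionCoprimeIsolatedResidual_of_kLineFlat` (EXISTC → GENΣ → KLINE♮ → RESΣ♭ → RES₃♭),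
`noRationalThreeTorsionCoprimeIsolatedResidual_of_kodaira` (EXISTC → GENΣ → KLINE♮ → E-an-212 → E-an-214 → RES₃♭).  File D
(`Theorems/ManinLocalTwoThreeMuThreeKodairaAtNine.lean`, 0599e6d001fbf58a; E-an-201R → GENΣ and the `_of_kPieces_kodaira` compositions) is a
PROVER-ONLY target (L-an-g39-2).  NOT IN PRINT: E-an-211's entry is «?» in the printed table; E-an-214's splitting is Vatsal 2005 §5 at
SEMISTABLE level only; E-an-212 is Manin-implied.  BC5 (an, exact local engines HOME/an/g39/census22/, mu3edge5-all.txt 025a675111980e70,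
CENSUS-kummerK-N1e5-an-g39.txt 5b3a8dc15f7784f3): E-an-211 22 105/22 105 μ₃-edges 9 ∣ N < 5·10⁵ (star → ascending 10 544, low → descending
11 561, III/IV carry no μ₃-line among 22 109 carriers), 0 exceptions; E-an-212 701/701 optimal low-type μ₃-carriers 9 ∣ N < 10⁵ Kummer-unbounded;
E-an-214 optimal non-split μ₃-carriers 9 970/9 970 LOW, optimal star carriers = {27a1, 54a1} (split) — D-an-24 (second engine) open.  CHEAPEST
FALSIFIERS: one μ₃-edge at additive 3 with (star, descending) or (low, ascending); an optimal 3B.1.2 curve of star type beyond 5·10⁵.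
REFUTER: ref1 R-an-76 PENDING at landing; ref2 PENDING.  Typer checks: 13 decl names fresh tree-wide; cite keys BarriosRoy2022LocalData /
DokchitserDokchitser2015LocalInvariants / Vatsal2005 / LingOesterle1991 in references.bib; no instances, no notation; 264 + note < 400 lines.
PARTITION 0 · beyond-print theorem: no · bears_on: stmt-BirchSwinnertonDyer-22968 (C3).  BSD is not proved by this; Manin `c = 1` is not
proved by this; C3 OPEN.
-/

noncomputable section

open scoped Classical

namespace Summit.BirchSwinnertonDyer.Rank1Residual.ManinAdditive.MuThreeEdgeKodaira

open WeierstrassCurve IsDedekindDomain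
  Literature.NumberTheory.DiophantineGeometry
  Literature.NumberTheory.EllipticCurves Literature.NumberTheory.EllipticCurves.ModularForms
  Summit.BirchSwinnertonDyer.Rank1Residual.Additive
  Summit.BirchSwinnertonDyer.Rank1Residual.ManinAdditive
  Summit.BirchSwinnertonDyer.Rank1Residual.ManinAdditive.CuspidalKummer
  Summit.BirchSwinnertonDyer.Rank1Residual.ManinAdditive.CuspidalKummerThree
  Summit.BirchSwinnertonDyer.Rank1Residual.ManinAdditive.ThreeIsogenyKernel
  Summit.BirchSwinnertonDyer.Rank1Residual.ManinAdditive.UDCKummerLine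
  Summit.BirchSwinnertonDyer.Rank1Residual.ManinAdditive.UDCKummerLineK

/-! ## §0 The two Kodaira classes at `3` -/

/-- «STAR» Kodaira class at `3`: the special fibre of the minimal regular model of `W` at `3` is of type IV*, III* or II*
(the additive types with `v₃(Δ_min) ≥ 8` in the potentially-good range; Tate's algorithm). [folklore] -/
def IsStarKodairaAtThree (W : WeierstrassCurve ℚ) : Prop :=
  W.kodairaSymbolAt (placeOf 3) = .IVstar ∨ W.kodairaSymbolAt (placeOf 3) = .IIIstar ∨ W.kodairaSymbolAt (placeOf 3) = .IIstar

/-- «LOW» Kodaira class at `3`: type II or Iₙ* (`n ≥ 0`). [folklore] -/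
def IsLowKodairaAtThree (W : WeierstrassCurve ℚ) : Prop :=
  W.kodairaSymbolAt (placeOf 3) = .II ∨ ∃ n, W.kodairaSymbolAt (placeOf 3) = .Istar n

/-- Star and low are disjoint (constructor discrimination). [folklore] -/
theorem not_isLowKodairaAtThree_of_isStar {W : WeierstrassCurve ℚ} (h : IsStarKodairaAtThree W) :
    ¬ IsLowKodairaAtThree W := by
  rintro (h₂ | ⟨n, h₂⟩) <;> rcases h with h | h | h <;> simp [h] at h₂

/-! ## §1 LAW E-an-211: the `μ₃`-edge Kodaira law at additive `3` -/

/-- **E-an-211 `MuThreeEdgeKodairaLaw` (cell bsd-f2-manin MEMO-an §83; LOCAL DATA LAW at `3`, candidate — nothing asserted).**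
`W, W₂` globally minimal over `ℚ`, `φ : W → W₂` a rational isogeny of degree `3` with `μ₃`-type kernel, `L, L₂` Néron period pairs,
`W` ADDITIVE at `3`.  Then: `φ` ascends (`covol Λ(W₂) = 3·covol Λ(W)`, Néron scalar `±3`) iff Kodaira(`W` at 3) ∈ {IV*, III*, II*};
`φ` descends (`3·covol Λ(W₂) = covol Λ(W)`, scalar `±1`) iff Kodaira ∈ {II, Iₙ*}; and Kodaira ∉ {III, IV}.  Census (BC5, exact):
22 105/22 105 `μ₃`-edges over all curves `9 ∣ N < 5·10⁵` (star → ascending 10 544: IV* 3 840 / III* 3 058 / II* 3 646; low → descending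
11 561: II 2 682 / I₀* 2 954 / Iₙ* 5 925; III, IV: no `μ₃`-line among 22 109 carriers), 0 exceptions; rational-kernel and generic-kernel
`3`-edges do NOT obey a source-Kodaira law (both directions occur for IV, IV*), the law is intrinsic to `μ₃`-kernels (dual form: a
`ℤ/3`-edge ascends iff its target is low).  In print: the scalar at `ℓ = p` additive potentially supersingular is «?» in [DokchitserDokchitser2015LocalInvariants, Table 1]
(arXiv:1208.5519 p.3, criterion (†)); this row determines it for `p = 3`, `μ₃`-kernels over `ℚ`.  Why it might fail: a wild case at
`3` (conductor exponent 3, 4, 5 all occur in the census) outside `N < 5·10⁵` where the formal group of a star-type curve fails to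
contain the `μ₃`-kernel — the provable route is a finite Tate/Vélu analysis over the Hessian family `y² + a₁xy + a₃y = x³`, not yet
done.  Why novel: names the Kodaira class, not `v₃(N)`, `c₃` or `w₃`, as the invariant deciding the Lie exponent of the `μ₃`-isogeny.
[cite: DokchitserDokchitser2015LocalInvariants, Table 1 and (†) (shape: the printed table leaves this entry undetermined)] [cite: BarriosRoy2022LocalData, Thm 3.8 (pattern: Kodaira data of an explicit torsion family at 3)] -/
@[conjecture]
def MuThreeEdgeKodairaLaw : Prop :=
  ∀ (W W₂ : WeierstrassCurve ℚ) [W.IsElliptic] [W.IsGloballyMinimal] [W₂.IsElliptic] [W₂.IsGloballyMinimal]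
    (φ : Isogeny W W₂) (L L₂ : PeriodPair),
    φ.degree = 3 → HasMuThreeKernel φ →
    IsNeronLatticeOf (W.baseChange ℂ) L → IsNeronLatticeOf (W₂.baseChange ℂ) L₂ →
    (W.kodairaSymbolAt (placeOf 3)).IsAdditive →
      (ZLattice.covolume L₂.lattice = 3 * ZLattice.covolume L.lattice ↔ IsStarKodairaAtThree W) ∧
      (3 * ZLattice.covolume L₂.lattice = ZLattice.covolume L.lattice ↔ IsLowKodairaAtThree W) ∧
      W.kodairaSymbolAt (placeOf 3) ≠ .III ∧ W.kodairaSymbolAt (placeOf 3) ≠ .IV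

/-- **E-an-211 ⟹ every `μ₃`-type ASCENDING `3`-edge at additive `3` issues from a star-type curve** (the direction used downstream;
one-line corollary, PROVED from the law). [folklore] -/
theorem isStarKodairaAtThree_of_ascending (hLAW : MuThreeEdgeKodairaLaw)
    {W W₂ : WeierstrassCurve ℚ} [W.IsElliptic] [W.IsGloballyMinimal] [W₂.IsElliptic] [W₂.IsGloballyMinimal]
    (φ : Isogeny W W₂) (L L₂ : PeriodPair) (hμ : HasMuThreeKernel φ) (hasc : IsAscendingThreeEdge φ L L₂)
    (hadd : (W.kodairaSymbolAt (placeOf 3)).IsAdditive) : IsStarKodairaAtThree W :=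
  (hLAW W W₂ φ L L₂ hasc.1 hμ hasc.2.1 hasc.2.2.1 hadd).1.mp hasc.2.2.2

/-! ## §2 The Shimura stratum of RES₃♭, Kodaira-typed -/

/-- **E-an-212 `NonShimuraMuThreeOfNonStarKodairaAtNine` (MEMO-an §83; DATA LAW implied by Manin's conjecture at 3 — nothing asserted).**
For a lattice-optimal datum (`Λ_E = cΛ₀(f)`, clause VERBATIM as in NB₃/RES₃♭) with `9 ∣ N` whose Kodaira type at `3` is NOT star, no
`3`-division value `u ∉ Λ_E`, `3u ∈ Λ_E` has all its `Γ₁(N)`-Kummer periods trivial — i.e. `3 ∤ #(E₀ ∩ Σ(N))`, the Shimura cover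
`E₁ → E₀` has degree prime to 3.  Manin ⟹ this (given E-an-211 and `ord₃(c₀) − ord₃(c₁) = 1 − v₃(n_φ)` on the stratum); converse
open.  Census (BC5): 701/701 optimal low-type `μ₃`-carriers `9 ∣ N < 10⁵` tested have an UNBOUNDED `μ₃`-Kummer cube root at a prime over
3, hence a nontrivial `Γ₁(N)`-period (CENSUS-kummerK-N1e5-an-g39.txt 5b3a8dc15f7784f3: the 688 orbit-minimal «χ₋₃-only ∪ isolated» classes of
HOME/data/D-an-18-coprime-partners-v1.tsv, 622 of them `μ₃`-lines (3B.1.2) and 66 generic (3B), ALL unbounded, `min_k v_𝔭(h_k) ≤ −5` by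
`k ≤ 20`; + the 13 classes of MEMO-an §82); by E-an-214's census every optimal `μ₃`-carrier `9 ∣ N < 5·10⁵` other than 27a1, 54a1 is of low
type, so the law's habitat there is all 10 192 of them.  For `u` of generic or rational type the conclusion is GENΣ / [LO91] (`Σ` is `μ`-type).  Why it might
fail: an optimal low-type curve beyond `10⁵` with `μ₃ ⊂ Σ(N)` — by E-an-211 its Shimura `3`-edge would DEScend and Manin would fail at 3
(`ord₃(c₀) ≥ 1`), so a counterexample is a counterexample to Manin.  Cheapest falsifier: a bounded `μ₃`-Kummer cube root on a low-type
optimal curve (kummerK2-an-g39.py, ≈ 0.2 s/curve). [cite: Vatsal2005, §1 Rem. 1.8 (shape: E₁ = E₀/(E₀ ∩ V))] [cite: LingOesterle1991, Thm. 1] -/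
@[conjecture]
def NonShimuraMuThreeOfNonStarKodairaAtNine : Prop :=
  ∀ (W : WeierstrassCurve ℚ) [W.IsElliptic] [W.IsGloballyMinimal] {N : ℕ} [NeZero N]
    (D : ModularParametrizationData W N),
    (∀ z ∈ D.L.lattice, ∃ w ∈ periodLattice D.f, z = D.c * w) → 3 ^ 2 ∣ N → ¬ IsStarKodairaAtThree W →
    ∀ u : ℂ, u ∉ D.L.lattice → 3 * u ∈ D.L.lattice → ¬ KummerShimura D u

/-- **E-an-214 `OptimalStarMuThreeCarrierSplitsAtNine` (MEMO-an §83; Stevens/Vatsal-type DATA LAW at additive 3 — nothing asserted).**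
A lattice-optimal datum with `9 ∣ N`, STAR Kodaira type at `3`, and a `μ₃`-type point of order `3` of the short model (rational abscissa,
ordinate in `√−3·ℚ`, `IsMuThreeType`) has a RATIONAL point of order `3` on the short model: the sequence
`0 → μ₃ → E₀[3] → ℤ/3 → 0` splits.  Census (BC5): optimal `μ₃`-carriers `9 ∣ N < 6·10⁴` = 2 290, star-type ones = {27a1, 54a1}, both
split (2/2); optimal NON-split carriers (3B.1.2) `9 ∣ N < 5·10⁵`: 9 970/9 970 of LOW type (0 star); optimal split low carriers: 222, all
of type II.  Optimality is load-bearing: 10 323 non-optimal non-split `μ₃`-carriers are star (27a2, 36a3, 54a2, …), 903 low.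
Why it might fail: a star-type X₀-optimal curve with mod-3 image 3B.1.2 beyond `5·10⁵` (Vatsal's Eisenstein splitting needs `J₀(N)`
semistable at 3 [Vatsal2005 §5]; no mechanism at `9 ∣ N` is known; under Manin ∧ E-an-211 such a curve has `μ₃ ⊄ Σ(N)`, so the law is
NOT implied by Manin — it is implied by Manin ∧ E-an-211 ∧ «an optimal curve ascends at 3 only along the Shimura cover», a Stevens-type
statement).  Cheapest falsifier: Kodaira type at 3 of the optimal 3B.1.2 curves of any further table (mu3kod5-driver.py, 2 s per 5·10⁵). [cite: Vatsal2005, §5 p.40 sequence (5), Thm. 1.1 (shape: the semistable splitting)] -/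
@[conjecture]
def OptimalStarMuThreeCarrierSplitsAtNine : Prop :=
  ∀ (W : WeierstrassCurve ℚ) [W.IsElliptic] [W.IsGloballyMinimal] {N : ℕ} [NeZero N]
    (D : ModularParametrizationData W N),
    (∀ z ∈ D.L.lattice, ∃ w ∈ periodLattice D.f, z = D.c * w) → 3 ^ 2 ∣ N → IsStarKodairaAtThree W →
    ∀ (X₀ : ℚ) (Y₀ : ℂ), IsShortThreeTorsionC W D.c X₀ Y₀ → IsMuThreeType Y₀ →
    ∃ X Y : ℚ, IsShortThreeTorsion W D.c X Y

/-- **RESΣ♭ `ShimuraMuThreeCaseAtNineFlat`: RESΣ (`UDCKummerLineK.ShimuraMuThreeCaseAtNine`) with RES₃♭'s own hypothesis «no rational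
point of order 3 on the short model» threaded** (so trivially implied by RESΣ, `shimuraMuThreeCaseAtNineFlat_of_resSigma`); it is the
form the Kodaira laws E-an-212 ∧ E-an-214 settle (`shimuraMuThreeCaseAtNineFlat_of_kodaira`) and it suffices for the split of RES₃♭
(`noRationalThreeTorsionCoprimeIsolatedResidual_of_kLineFlat`).  Why it might fail: as Manin. [cite: Vatsal2005, Conj. 1.9 (Stevens; shape)] -/
@[conjecture]
def ShimuraMuThreeCaseAtNineFlat : Prop :=
  ∀ (W : WeierstrassCurve ℚ) [W.IsElliptic] [W.IsGloballyMinimal] {N : ℕ} [NeZero N]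
    (D : ModularParametrizationData W N),
    (∀ z ∈ D.L.lattice, ∃ w ∈ periodLattice D.f, z = D.c * w) → 3 ^ 2 ∣ N →
    (∀ X Y : ℚ, ¬ IsShortThreeTorsion W D.c X Y) →
    ∀ (X₀ : ℚ) (Y₀ : ℂ), IsShortThreeTorsionC W D.c X₀ Y₀ → IsMuThreeType Y₀ →
    ∀ u : ℂ, u ∉ D.L.lattice → 3 * u ∈ D.L.lattice →
    (D.c : ℂ) ^ 2 * D.L.weierstrassP u = (X₀ : ℂ) → (D.c : ℂ) ^ 3 * D.L.derivWeierstrassP u / 2 = Y₀ →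
    KummerShimura D u → ¬ (3 : ℤ) ∣ D.c

/-- RESΣ ⟹ RESΣ♭ (drop the extra hypothesis). [folklore] -/
theorem shimuraMuThreeCaseAtNineFlat_of_resSigma (h : ShimuraMuThreeCaseAtNine) : ShimuraMuThreeCaseAtNineFlat :=
  fun W _ _ _ _ D hopt h9 _ X₀ Y₀ hTC hμ u hu₁ hu₂ hX hY hS ↦ h W D hopt h9 X₀ Y₀ hTC hμ u hu₁ hu₂ hX hY hS

/-- **PROVED: the Shimura stratum of RES₃♭ is EMPTY given the two Kodaira laws — `E-an-212 → E-an-214 → RESΣ♭`.**  Star type: E-an-214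
produces a rational point of order 3, contradicting RES₃♭'s hypothesis; non-star type: E-an-212 says the `μ₃`-line is not Shimura,
contradicting the case hypothesis.  The Manin constant is not touched. [folklore] -/
theorem shimuraMuThreeCaseAtNineFlat_of_kodaira (h212 : NonShimuraMuThreeOfNonStarKodairaAtNine)
    (h214 : OptimalStarMuThreeCarrierSplitsAtNine) : ShimuraMuThreeCaseAtNineFlat := by
  intro W _ _ N _ D hopt h9 hT X₀ Y₀ hTC hμ u hu₁ hu₂ _ _ hS
  by_cases hstar : IsStarKodairaAtThree W
  · obtain ⟨X, Y, hXY⟩ := h214 W D hopt h9 hstar X₀ Y₀ hTC hμ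
    exact absurd hXY (hT X Y)
  · exact absurd hS (h212 W D hopt h9 hstar u hu₁ hu₂)

/-- **THE RE-SPLIT (PROVED): RES₃♭ ⟸ EXISTC ∧ GENΣ ∧ KLINE♮ ∧ RESΣ♭** — the proof of
`UDCKummerLineK.noRationalThreeTorsionCoprimeIsolatedResidual_of_kLine` with RES₃♭'s hypothesis `hT` handed to the Shimura case. [folklore] -/
theorem noRationalThreeTorsionCoprimeIsolatedResidual_of_kLineFlat
    (hEX : ReducibleShortThreeTorsionLiftC) (hGEN : KummerNotShimuraOfGeneric)
    (hKL : NonShimuraThreeTorsionCaseAtNineGermFree)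
    (hRES : ShimuraMuThreeCaseAtNineFlat) : NoRationalThreeTorsionCoprimeIsolatedResidual := by
  intro W _ _ N _ D hL h9 _ _ _ _ _ _ _ hred hT
  obtain ⟨X₀, Y₀, u, hTC, hirr, hu₁, hu₂, hX, hY⟩ := hEX W D hred hT
  by_cases hS : KummerShimura D u
  · by_cases hμ : IsMuThreeType Y₀
    · exact hRES W D hL h9 hT X₀ Y₀ hTC hμ u hu₁ hu₂ hX hY hS
    · exact fun _ ↦ hGEN W D hL h9 X₀ Y₀ hTC hirr hμ u hu₁ hu₂ hX hY hS
  · exact hKL W D h9 hL X₀ Y₀ hTC u hu₁ hu₂ hX hY hS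

/-- **NET (PROVED): RES₃♭ ⟸ EXISTC ∧ GENΣ ∧ KLINE♮ ∧ E-an-212 ∧ E-an-214.** [folklore] -/
theorem noRationalThreeTorsionCoprimeIsolatedResidual_of_kodaira
    (hEX : ReducibleShortThreeTorsionLiftC) (hGEN : KummerNotShimuraOfGeneric)
    (hKL : NonShimuraThreeTorsionCaseAtNineGermFree)
    (h212 : NonShimuraMuThreeOfNonStarKodairaAtNine) (h214 : OptimalStarMuThreeCarrierSplitsAtNine) :
    NoRationalThreeTorsionCoprimeIsolatedResidual :=
  noRationalThreeTorsionCoprimeIsolatedResidual_of_kLineFlat hEX hGEN hKL (shimuraMuThreeCaseAtNineFlat_of_kodaira h212 h214)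

/-! ## §3 E-an-201 repaired: the `μ`-type law with the `3`-part hypothesis -/

/-- **E-an-201R `ShimuraKernelMuTypeAtNineR` (repairs the landed `UDCKummerLineK.ShimuraKernelMuTypeAtNine`, see the module docstring;
candidate — the printed engine [LO91, Thm 1] «`Σ(N)` is of `μ`-type» in lattice currency, nothing asserted).**  For a lattice-optimal
datum at `9 ∣ N` whose `Γ₁(N)`-period lattice lies in a LINE modulo `3`: `Λ₁(f) ⊆ ℤg + 3Λ₀(f)` for some `g ∈ Λ₀(f) ∖ 3Λ₀(f)` (⟺
`3 ∣ [Λ₀(f) : Λ₁(f)] = #(E₀ ∩ Σ(N))`; DICTΣ `KummerShimuraLattice` gives it with `g = 3u/c` from trivial `Γ₁(N)`-Kummer periods):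
(a) `Λ₁(f) ⊄ 3Λ₀(f)` (the `3`-part of the kernel is CYCLIC — Weil pairing) and (b) every `w ∈ Λ₁(f) ∖ 3Λ₀(f)` gives a kernel point
`P = c·w/3 ∈ (E₀ ∩ Σ)[3] ∖ 0` with RATIONAL abscissa and ordinate in `√−3·ℚ` on the short model `E_{W,c}` (`σP = ω(σ)P`).  The
hypothesis of the landed E-an-201 (`Λ₁(f) ≠ Λ₀(f)`) also admits kernels of order prime to 3, for which (b) is false; this row is the
corrected one and the GENΣ edge is re-proved from it (Theorems side, `kummerNotShimuraOfGeneric_of_muTypeR`).  BC5: 27a1 (`P = (0, Y)`,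
`Y² ∈ −3ℚ²`), 54a1 (`X = −9/4`).  Why it might fail: not on paper ([LO91, Thm 1] for every `N`); Lean cost = Galois action on `E(ℚ̄)`
versus the analytic uniformisation (and «Σ of μ-type» is not yet a tree fact).  Cheapest falsifier: a class with `3 ∣ #(E₀ ∩ Σ)` whose
kernel abscissa is irrational (none). [cite: LingOesterle1991, Thm. 1] [cite: Vatsal2005, §1 Rem. 1.8] -/
@[conjecture]
def ShimuraKernelMuTypeAtNineR : Prop :=
  ∀ (W : WeierstrassCurve ℚ) [W.IsElliptic] [W.IsGloballyMinimal] {N : ℕ} [NeZero N]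
    (D : ModularParametrizationData W N),
    (∀ z ∈ D.L.lattice, ∃ w ∈ periodLattice D.f, z = D.c * w) → 3 ^ 2 ∣ N →
    (∃ g ∈ periodLattice D.f, (¬ ∃ v ∈ periodLattice D.f, g = 3 * v) ∧
      ∀ w ∈ periodLatticeGamma1 D.f, ∃ k : ℤ, ∃ v ∈ periodLattice D.f, w = k * g + 3 * v) →
    (∃ w ∈ periodLatticeGamma1 D.f, ¬ ∃ v ∈ periodLattice D.f, w = 3 * v) ∧
    ∀ w ∈ periodLatticeGamma1 D.f, (¬ ∃ v ∈ periodLattice D.f, w = 3 * v) →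
      ∃ X r : ℚ, (D.c : ℂ) ^ 2 * D.L.weierstrassP ((D.c : ℂ) * w / 3) = (X : ℂ) ∧
        ((D.c : ℂ) ^ 3 * D.L.derivWeierstrassP ((D.c : ℂ) * w / 3) / 2) ^ 2 = -3 * (r : ℂ) ^ 2

end Summit.BirchSwinnertonDyer.Rank1Residual.ManinAdditive.MuThreeEdgeKodaira

end
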